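/-
Copyright (c) 2026 the pub-hodgecm-mathlib formalisation cell (harness21).  Prover seat hodgecm-mathlib-K2E1-p02 (g5), Track B ∕ K2-LIT,
h413 = `stmt-HodgeConjecture-24833`, line `K2_E1_TraceFormulaBeta`, campaign RES-RANK-ONE ∕ «EIS-RANK-ONE»: the K2Liu JUNCTION at `n = 1` —
`U(Φ₂)` IS the doubled unitary group `U(𝕍 ⊕ −𝕍)` of a hermitian line, its Borel IS the Siegel parabolic `P_Δ`.  2026-09-04.
-/
import Summits.HodgeConjecture.HodgeConjecture.Theorems.K2LiuSiegelEisensteinDoubledSummable        -- ★ p856279 (K2Liu #9) + the doubled currency (GR91, K2Lit)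
import Summits.HodgeConjecture.HodgeConjecture.Theorems.K2LiuSiegelEisensteinDoubledLeftInvariant   -- ★ K2Liu #10b: `apply_siegelDeltaRat_mul`, left invariance
import Literature.NumberTheory.Automorphic.AdelicUnitaryGroupDatum                                 -- ★ `cmDatum`, `adelicUnitaryGroupCongr`
import HarnessLib

/-!
# h413 ∕ Track B «K2-LIT», «EIS-RANK-ONE» — helper `K2E1BorelEisensteinU2FromK2Liu` (part 1: the dictionary):
# `U(Φ₂) ≅ U(𝕍 ⊕ −𝕍)` for the hermitian line `𝕍 = (L, 1)`, Borel `↦` Siegel parabolic `P_Δ`, `b ↦ b₀₀ = det_Δ`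

Cell `pub/hodgecm-mathlib`, crux H413 = `stmt-HodgeConjecture-24833`, route `HCCMUnconditional`; chair K2-lead (g0); DEAL of the dealer K2E1-plan (g2)
2026-09-04T03:59:41Z ∕ «=» 04:04:46Z on the memo `K2/K2E1-p02/g5/MEMO-K2Liu-junction-m1.md` (ca70ef491cb4e779).  THEOREMS ONLY (no `def`, no `instance`,
no `notation`, no named-fact hypothesis, no `sorry`); lane `--kind proof --supports stmt-HodgeConjecture-24833 --as helper` (count-neutral).

THE POINT.  All ★ analytic theorems of the K2Liu road (absolute convergence #9, automorphy #10, Iwasawa datum, heights #15, intertwining O41.3, constant term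
O41.4, and the LIVE continuation socket #41) are typed on the DOUBLED carrier `HA L e dV hdV dW hdW = U(𝕍 ⊕ −𝕍)(𝔸_{L⁺})` of ★ `GelbartRogawski1991.GRConstruction`
with its Siegel parabolic `P_Δ = Stab(Δ)`, `Δ = {(x,x)}` (★ `IsSiegelDelta`, `detDelta`, `K2Lit.SiegelDoubled`).  At `n = 1` — the hermitian LINE `𝕍 = V ⊗ W`,
`V = W = (L, 1)`: `e = Equiv.prodUnique (Fin 1) (Fin 1)`, `dV = dW = 1` — the doubled form is `diag(1, −1)` (`hermD_one_apply`) and the RATIONAL CONGRUENCE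
`S = (1 ½; 1 −½) ∈ GL₂(L⁺)`, `Sᵀ·diag(1,−1)·S = Φ₂ = antidiag(1,1)` (`bridge_congr`), conjugates the route's `U(Φ₂) = (cmDatum L 2 Φ₂)` ONTO `U(𝕍 ⊕ −𝕍)`:
`Ψ_S := ★ adelicUnitaryGroupCongr L S diag(1,−1) Φ₂ _ : U(Φ₂)(𝔸) ≃ₜ* H(𝔸)`, `g ↦ S_𝔸 g S_𝔸⁻¹`.  Since `S e₁ = (1,1)ᵀ` spans `Δ`, the dictionary is:

* `isSiegelDelta_bridge_iff` — `Ψ_S g ∈ P_Δ(𝔸) ↔ g₁₀ = 0` (the route's Borel corner test, ★ p857160 `mem_borelU_iff_apply_eq_zero_two`);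
* `detDelta_bridge` — for `g₁₀ = 0`, `det_Δ(Ψ_S g) = g₀₀`: the inducing character `χ(det_Δ p)|det_Δ p|^{s+n/2}` of K2Liu's `I_Δ(s,χ)` pulls back to
  `χ(b₀₀)‖b₀₀‖_{𝔸_L}^{s+1/2}`, the NORMALISED rank-one induction from the Borel of `U(1,1)` (`δ_B^{1/2}(diag(t, t̄⁻¹)) = ‖t‖_{𝔸_L}^{1/2}`), so Borel sections of
  `U(Φ₂)` ARE Siegel sections at `n = 1` (`isSiegelDeltaSection_comp_bridge_symm`);
* `bridge_mem_ratH` ∕ `bridge_symm_mem_arithmeticSubgroup` — rational points correspond (★ `adelicUnitaryGroupCongr_mem_rat`), hence `B(L⁺) ↔ P_Δ(L⁺)`;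
* (part 2, file `K2E1BorelEisensteinU2FromK2LiuTransport`) the transported theorems: absolute convergence of the Borel Eisenstein series of `U(Φ₂)` on `Re s > 1/2`
  and its left `U(Φ₂)(L⁺)`-invariance, from ★ K2Liu #9 ∕ #10b.
The statements quantify over `S : GL (Fin 2) L` PINNED by its matrix (`(S : Matrix) = !![1, 2⁻¹; 1, -2⁻¹]`, `(S⁻¹ : Matrix) = !![2⁻¹, 2⁻¹; 1, -1]`), so that no
definition is introduced; `exists_bridgeMatrix` provides such an `S`.

HONEST LABEL.  Count-neutral helper; proves no printed statement; HC_CM is proved only modulo the 7 printed citations (2 remaining named inputs: hLiu418 =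
`stmt-HodgeConjecture-24832`, h413 = `stmt-HodgeConjecture-24833`) until rung 0 closes.  The continuation of the Eisenstein series (K2Liu socket #41) is LIVE
and is not claimed here.

## References
* [MoeglinWaldspurger1995] C. Mœglin, J.-L. Waldspurger, *Spectral decomposition and Eisenstein series* (1995), I.1.4 (rank one), II.1.5–II.1.7.
* [Tan1999] V. Tan, *Poles of Siegel Eisenstein series on U(n,n)*, Canad. J. Math. 51 (1999), §1 (`U(1,1)` = the case `n = 1`).
* [GelbartRogawski1991] S. Gelbart, J. Rogawski, *L-functions and Fourier–Jacobi coefficients for U(3)*, Invent. Math. 105 (1991), §3.1 (the doubled group).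
* [PlatonovRapinchuk1994] V. Platonov, A. Rapinchuk, *Algebraic Groups and Number Theory* (1994), §2.3 (congruent forms, conjugate unitary groups).
-/

set_option autoImplicit false
set_option linter.dupNamespace false  -- the mandated namespace repeats the summit's segment (`HodgeConjecture.HodgeConjecture`)

noncomputable section

open scoped Matrix
open NumberField IsDedekindDomain
open Literature.NumberTheory.Automorphic Literature.NumberTheory.Automorphic.UnitaryGroup Literature.NumberTheory.GaloisRepresentations
open Literature.NumberTheory.GelbartRogawski1991 Literature.NumberTheory.GelbartRogawski1991.GRConstruction
open Literature.NumberTheory.K2Lit.SiegelDoubled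

namespace Summit.HodgeConjecture.HodgeConjecture.Cruxes.H413.K2E1BorelEisensteinU2FromK2Liu

variable (L : Type) [Field L] [NumberField L] [IsCMField L]

/-! ## §1 The doubled form of the hermitian line is `diag(1,−1)`; the congruence `Sᵀ diag(1,−1) S = Φ₂` -/

/-- `finSumFinEquiv.symm 0 = inl 0` on `Fin (1+1)`. [folklore] -/
theorem finSumFinEquiv_symm_zero : (finSumFinEquiv.symm (0 : Fin (1 + 1)) : Fin 1 ⊕ Fin 1) = Sum.inl 0 := by decide

/-- `finSumFinEquiv.symm 1 = inr 0` on `Fin (1+1)`. [folklore] -/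
theorem finSumFinEquiv_symm_one : (finSumFinEquiv.symm (1 : Fin (1 + 1)) : Fin 1 ⊕ Fin 1) = Sum.inr 0 := by decide

/-- `finSumFinEquiv (inl 0) = 0` on `Fin (1+1)`. [folklore] -/
theorem finSumFinEquiv_inl_zero : (finSumFinEquiv (Sum.inl (0 : Fin 1)) : Fin (1 + 1)) = 0 := by decide

/-- `finSumFinEquiv (inr 0) = 1` on `Fin (1+1)`. [folklore] -/
theorem finSumFinEquiv_inr_zero : (finSumFinEquiv (Sum.inr (0 : Fin 1)) : Fin (1 + 1)) = 1 := by decide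

/-- The rational Gram matrix of the hermitian line `𝕍 = (L,1) ⊗ (L,1)` is `(1)`. [cite: GelbartRogawski1991, §3.1] -/
theorem gramR_one :
    gramR L (Equiv.prodUnique (Fin 1) (Fin 1)) (fun _ => (1 : L)) (fun _ => map_one _) (fun _ => (1 : L)) (fun _ => map_one _) = 1 := by
  ext i j
  have hi : i = 0 := Subsingleton.elim _ _
  have hj : j = 0 := Subsingleton.elim _ _
  subst hi hj
  simp [gramR, UnitaryDualPair.gram, UnitaryDualPair.realDiagonal, Matrix.reindex_apply, Matrix.kroneckerMap_apply]

/-- **The doubled form of the hermitian line is `diag(1, −1)`**: `hermD = J ⊕ (−J)` with `J = (1)`. [cite: GelbartRogawski1991, §3.1] -/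
theorem hermD_one_apply (i j : Fin (1 + 1)) :
    hermD L (Equiv.prodUnique (Fin 1) (Fin 1)) (fun _ => (1 : L)) (fun _ => map_one _) (fun _ => (1 : L)) (fun _ => map_one _) i j =
      (!![(1 : L), 0; 0, -1] : Matrix (Fin 2) (Fin 2) L) i j := by
  rw [hermD, gramD, gramR_one]
  fin_cases i <;> fin_cases j <;>
    simp [Matrix.reindex_apply, Matrix.submatrix_apply, e₂, finSumFinEquiv_symm_zero, finSumFinEquiv_symm_one,
      Matrix.fromBlocks_apply₁₁, Matrix.fromBlocks_apply₁₂, Matrix.fromBlocks_apply₂₁, Matrix.fromBlocks_apply₂₂]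

/-- The same as a matrix identity `hermD = diag(1,−1)` (index types `Fin (1+1)` and `Fin 2` agree definitionally). [cite: GelbartRogawski1991, §3.1] -/
theorem hermD_one_eq :
    hermD L (Equiv.prodUnique (Fin 1) (Fin 1)) (fun _ => (1 : L)) (fun _ => map_one _) (fun _ => (1 : L)) (fun _ => map_one _) =
      (!![(1 : L), 0; 0, -1] : Matrix (Fin 2) (Fin 2) L) :=
  Matrix.ext (hermD_one_apply L)

/-- **THE CONGRUENCE `Sᵀ · diag(1,−1) · S = Φ₂`** for `S = (1 ½; 1 −½)` (entries in `ℚ ⊆ L⁺`, so `c(S) = S`): the split hermitian plane written on the basis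
`(e₁ + e₂∕2, e₁ − e₂∕2)`.  `Φ₂` is the route's literal `antidiag(1,1)`. [cite: PlatonovRapinchuk1994, §2.3] -/
theorem bridge_congr (S : GL (Fin 2) L) (hS : (S : Matrix (Fin 2) (Fin 2) L) = !![1, 2⁻¹; 1, -2⁻¹]) :
    ((S : Matrix (Fin 2) (Fin 2) L).map (cmConjRingHom L))ᵀ *
        hermD L (Equiv.prodUnique (Fin 1) (Fin 1)) (fun _ => (1 : L)) (fun _ => map_one _) (fun _ => (1 : L)) (fun _ => map_one _) *
        (S : Matrix (Fin 2) (Fin 2) L) =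
      (Matrix.of fun i j : Fin 2 => if i.val + j.val + 1 = 2 then (1 : L) else 0) := by
  rw [hermD_one_eq, hS]
  ext i j
  fin_cases i <;> fin_cases j <;>
    simp [Matrix.mul_apply, Fin.sum_univ_two, Matrix.map_apply, map_inv₀, map_ofNat] <;> norm_num

omit [IsCMField L] in
/-- **A pinned congruence matrix exists**: `S ∈ GL₂(L)` with `S = (1 ½; 1 −½)` and `S⁻¹ = (½ ½; 1 −1)`. [folklore] -/
theorem exists_bridgeMatrix :
    ∃ S : GL (Fin 2) L, (S : Matrix (Fin 2) (Fin 2) L) = !![1, 2⁻¹; 1, -2⁻¹] ∧ ((S⁻¹ : GL (Fin 2) L) : Matrix (Fin 2) (Fin 2) L) = !![2⁻¹, 2⁻¹; 1, -1] := by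
  refine ⟨⟨!![1, 2⁻¹; 1, -2⁻¹], !![2⁻¹, 2⁻¹; 1, -1], ?_, ?_⟩, rfl, rfl⟩
  · ext i j
    fin_cases i <;> fin_cases j <;> simp [Matrix.mul_apply, Fin.sum_univ_two] <;> norm_num
  · ext i j
    fin_cases i <;> fin_cases j <;> simp [Matrix.mul_apply, Fin.sum_univ_two] <;> norm_num

/-! ## §2 The dictionary: `Ψ_S g ∈ P_Δ ↔ g₁₀ = 0`, `det_Δ(Ψ_S b) = b₀₀`, Borel sections are Siegel sections -/

/-- The matrix of `Ψ_S g = S_𝔸 g S_𝔸⁻¹` (★ `coe_adelicUnitaryGroupCongr`). [folklore] -/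
theorem coe_bridge (S : GL (Fin 2) L) (hS : (S : Matrix (Fin 2) (Fin 2) L) = !![1, 2⁻¹; 1, -2⁻¹])
    (g : adelicUnitaryGroup L (Matrix.of fun i j : Fin 2 => if i.val + j.val + 1 = 2 then (1 : L) else 0)) :
    ((adelicUnitaryGroupCongr L S _ _ (bridge_congr L S hS) g :
        adelicUnitaryGroup L (hermD L (Equiv.prodUnique (Fin 1) (Fin 1)) (fun _ => (1 : L)) (fun _ => map_one _) (fun _ => (1 : L)) (fun _ => map_one _))) :
        GL (Fin 2) (AdeleRing (𝓞 L) L)) =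
      toAdeleGL L S * (g : GL (Fin 2) (AdeleRing (𝓞 L) L)) * (toAdeleGL L S)⁻¹ :=
  rfl

/-- **Entries of the doubled block form at `n = 1`**: the four `1 × 1` blocks of `blk h` are the four entries of the `2 × 2` matrix of `h`. [folklore] -/
theorem blk_toBlocks_one (h : HA L (Equiv.prodUnique (Fin 1) (Fin 1)) (fun _ => (1 : L)) (fun _ => map_one _) (fun _ => (1 : L)) (fun _ => map_one _)) :
    (blk L (Equiv.prodUnique (Fin 1) (Fin 1)) (fun _ => (1 : L)) (fun _ => map_one _) (fun _ => (1 : L)) (fun _ => map_one _) h).toBlocks₁₁ 0 0 =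
        ((h : GL (Fin (1 + 1)) (AdeleRing (𝓞 L) L)) : Matrix (Fin (1 + 1)) (Fin (1 + 1)) (AdeleRing (𝓞 L) L)) 0 0 ∧
      (blk L (Equiv.prodUnique (Fin 1) (Fin 1)) (fun _ => (1 : L)) (fun _ => map_one _) (fun _ => (1 : L)) (fun _ => map_one _) h).toBlocks₁₂ 0 0 =
        ((h : GL (Fin (1 + 1)) (AdeleRing (𝓞 L) L)) : Matrix (Fin (1 + 1)) (Fin (1 + 1)) (AdeleRing (𝓞 L) L)) 0 1 ∧
      (blk L (Equiv.prodUnique (Fin 1) (Fin 1)) (fun _ => (1 : L)) (fun _ => map_one _) (fun _ => (1 : L)) (fun _ => map_one _) h).toBlocks₂₁ 0 0 =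
        ((h : GL (Fin (1 + 1)) (AdeleRing (𝓞 L) L)) : Matrix (Fin (1 + 1)) (Fin (1 + 1)) (AdeleRing (𝓞 L) L)) 1 0 ∧
      (blk L (Equiv.prodUnique (Fin 1) (Fin 1)) (fun _ => (1 : L)) (fun _ => map_one _) (fun _ => (1 : L)) (fun _ => map_one _) h).toBlocks₂₂ 0 0 =
        ((h : GL (Fin (1 + 1)) (AdeleRing (𝓞 L) L)) : Matrix (Fin (1 + 1)) (Fin (1 + 1)) (AdeleRing (𝓞 L) L)) 1 1 := by
  simp only [blk, Matrix.toBlocks₁₁, Matrix.toBlocks₁₂, Matrix.toBlocks₂₁, Matrix.toBlocks₂₂, Matrix.reindex_apply, Matrix.submatrix_apply,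
    Equiv.symm_symm, Matrix.of_apply, e₂, finSumFinEquiv_inl_zero, finSumFinEquiv_inr_zero, and_self]

/-- A `1 × 1` matrix identity is an identity of the `(0,0)` entries. [folklore] -/
theorem matrix_fin_one_eq_iff {R : Type*} (A B : Matrix (Fin 1) (Fin 1) R) : A = B ↔ A 0 0 = B 0 0 := by
  constructor
  · intro h
    rw [h]
  · intro h
    ext i j
    have hi : i = 0 := Subsingleton.elim _ _
    have hj : j = 0 := Subsingleton.elim _ _
    subst hi hj
    exact h

/-- **`P_Δ` AT `n = 1` IN ENTRIES**: `h ∈ P_Δ(𝔸) ↔ h₀₀ + h₀₁ = h₁₀ + h₁₁` (the two row sums agree: `h` stabilises the line `⟨(1,1)⟩`). [cite: GelbartRogawski1991, §3.1] -/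
theorem isSiegelDelta_one_iff (h : HA L (Equiv.prodUnique (Fin 1) (Fin 1)) (fun _ => (1 : L)) (fun _ => map_one _) (fun _ => (1 : L)) (fun _ => map_one _)) :
    IsSiegelDelta L (Equiv.prodUnique (Fin 1) (Fin 1)) (fun _ => (1 : L)) (fun _ => map_one _) (fun _ => (1 : L)) (fun _ => map_one _) h ↔
      ((h : GL (Fin (1 + 1)) (AdeleRing (𝓞 L) L)) : Matrix (Fin (1 + 1)) (Fin (1 + 1)) (AdeleRing (𝓞 L) L)) 0 0 +
          ((h : GL (Fin (1 + 1)) (AdeleRing (𝓞 L) L)) : Matrix (Fin (1 + 1)) (Fin (1 + 1)) (AdeleRing (𝓞 L) L)) 0 1 =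
        ((h : GL (Fin (1 + 1)) (AdeleRing (𝓞 L) L)) : Matrix (Fin (1 + 1)) (Fin (1 + 1)) (AdeleRing (𝓞 L) L)) 1 0 +
          ((h : GL (Fin (1 + 1)) (AdeleRing (𝓞 L) L)) : Matrix (Fin (1 + 1)) (Fin (1 + 1)) (AdeleRing (𝓞 L) L)) 1 1 := by
  obtain ⟨h11, h12, h21, h22⟩ := blk_toBlocks_one L h
  rw [IsSiegelDelta, matrix_fin_one_eq_iff, Matrix.add_apply, Matrix.add_apply, h11, h12, h21, h22]

/-- **`det_Δ` AT `n = 1` IN ENTRIES**: `det_Δ h = h₀₀ + h₀₁`. [cite: GelbartRogawski1991, §3.1] -/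
theorem detDelta_one_eq (h : HA L (Equiv.prodUnique (Fin 1) (Fin 1)) (fun _ => (1 : L)) (fun _ => map_one _) (fun _ => (1 : L)) (fun _ => map_one _)) :
    detDelta L (Equiv.prodUnique (Fin 1) (Fin 1)) (fun _ => (1 : L)) (fun _ => map_one _) (fun _ => (1 : L)) (fun _ => map_one _) h =
      ((h : GL (Fin (1 + 1)) (AdeleRing (𝓞 L) L)) : Matrix (Fin (1 + 1)) (Fin (1 + 1)) (AdeleRing (𝓞 L) L)) 0 0 +
        ((h : GL (Fin (1 + 1)) (AdeleRing (𝓞 L) L)) : Matrix (Fin (1 + 1)) (Fin (1 + 1)) (AdeleRing (𝓞 L) L)) 0 1 := by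
  obtain ⟨h11, h12, -, -⟩ := blk_toBlocks_one L h
  rw [detDelta, deltaBlock, Matrix.det_fin_one, Matrix.add_apply, h11, h12]

/-- **THE TWO ROW SUMS OF `Ψ_S g = S_𝔸 g S_𝔸⁻¹`**: `h₀₀ + h₀₁ = g₀₀ + ½ g₁₀` and `h₁₀ + h₁₁ = g₀₀ − ½ g₁₀` (`½ = (2⁻¹)_𝔸`; a `2 × 2` computation with
`S = (1 ½; 1 −½)`, `S⁻¹ = (½ ½; 1 −1)`). [folklore] -/
theorem bridge_rowsum (S : GL (Fin 2) L) (hS : (S : Matrix (Fin 2) (Fin 2) L) = !![1, 2⁻¹; 1, -2⁻¹])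
    (hS' : ((S⁻¹ : GL (Fin 2) L) : Matrix (Fin 2) (Fin 2) L) = !![2⁻¹, 2⁻¹; 1, -1])
    (g : adelicUnitaryGroup L (Matrix.of fun i j : Fin 2 => if i.val + j.val + 1 = 2 then (1 : L) else 0)) :
    ((toAdeleGL L S * (g : GL (Fin 2) (AdeleRing (𝓞 L) L)) * (toAdeleGL L S)⁻¹ : GL (Fin 2) (AdeleRing (𝓞 L) L)) :
          Matrix (Fin 2) (Fin 2) (AdeleRing (𝓞 L) L)) 0 0 +
        ((toAdeleGL L S * (g : GL (Fin 2) (AdeleRing (𝓞 L) L)) * (toAdeleGL L S)⁻¹ : GL (Fin 2) (AdeleRing (𝓞 L) L)) :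
          Matrix (Fin 2) (Fin 2) (AdeleRing (𝓞 L) L)) 0 1 =
        ((g : GL (Fin 2) (AdeleRing (𝓞 L) L)) : Matrix (Fin 2) (Fin 2) (AdeleRing (𝓞 L) L)) 0 0 +
          algebraMap L (AdeleRing (𝓞 L) L) 2⁻¹ * ((g : GL (Fin 2) (AdeleRing (𝓞 L) L)) : Matrix (Fin 2) (Fin 2) (AdeleRing (𝓞 L) L)) 1 0 ∧
      ((toAdeleGL L S * (g : GL (Fin 2) (AdeleRing (𝓞 L) L)) * (toAdeleGL L S)⁻¹ : GL (Fin 2) (AdeleRing (𝓞 L) L)) :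
          Matrix (Fin 2) (Fin 2) (AdeleRing (𝓞 L) L)) 1 0 +
        ((toAdeleGL L S * (g : GL (Fin 2) (AdeleRing (𝓞 L) L)) * (toAdeleGL L S)⁻¹ : GL (Fin 2) (AdeleRing (𝓞 L) L)) :
          Matrix (Fin 2) (Fin 2) (AdeleRing (𝓞 L) L)) 1 1 =
        ((g : GL (Fin 2) (AdeleRing (𝓞 L) L)) : Matrix (Fin 2) (Fin 2) (AdeleRing (𝓞 L) L)) 0 0 -
          algebraMap L (AdeleRing (𝓞 L) L) 2⁻¹ * ((g : GL (Fin 2) (AdeleRing (𝓞 L) L)) : Matrix (Fin 2) (Fin 2) (AdeleRing (𝓞 L) L)) 1 0 := by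
  have ht : algebraMap L (AdeleRing (𝓞 L) L) 2⁻¹ + algebraMap L (AdeleRing (𝓞 L) L) 2⁻¹ = 1 := by
    rw [← map_add, show (2⁻¹ : L) + 2⁻¹ = 1 by norm_num, map_one]
  rw [← map_inv (toAdeleGL L) S]
  simp only [Units.val_mul, val_toAdeleGL, hS, hS', Matrix.mul_apply, Fin.sum_univ_two, Matrix.map_apply, Matrix.of_apply, Matrix.cons_val',
    Matrix.cons_val_zero, Matrix.cons_val_one, Matrix.empty_val', Matrix.cons_val_fin_one, map_one, map_neg]
  constructor
  · linear_combination (((g : GL (Fin 2) (AdeleRing (𝓞 L) L)) : Matrix (Fin 2) (Fin 2) (AdeleRing (𝓞 L) L)) 0 0 +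
      algebraMap L (AdeleRing (𝓞 L) L) 2⁻¹ * ((g : GL (Fin 2) (AdeleRing (𝓞 L) L)) : Matrix (Fin 2) (Fin 2) (AdeleRing (𝓞 L) L)) 1 0) * ht
  · linear_combination (((g : GL (Fin 2) (AdeleRing (𝓞 L) L)) : Matrix (Fin 2) (Fin 2) (AdeleRing (𝓞 L) L)) 0 0 -
      algebraMap L (AdeleRing (𝓞 L) L) 2⁻¹ * ((g : GL (Fin 2) (AdeleRing (𝓞 L) L)) : Matrix (Fin 2) (Fin 2) (AdeleRing (𝓞 L) L)) 1 0) * ht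

/-- **BOREL `↦` SIEGEL PARABOLIC**: `Ψ_S g ∈ P_Δ(𝔸) ↔ g₁₀ = 0` — the route's Borel corner test of `U(Φ₂)` (★ p857160 `mem_borelU_iff_apply_eq_zero_two`)
is the stabiliser condition of the diagonal Lagrangian `Δ = ⟨S e₁⟩ = ⟨(1,1)⟩`. [cite: GelbartRogawski1991, §3.1] [cite: Tan1999, §1] -/
theorem isSiegelDelta_bridge_iff (S : GL (Fin 2) L) (hS : (S : Matrix (Fin 2) (Fin 2) L) = !![1, 2⁻¹; 1, -2⁻¹])
    (hS' : ((S⁻¹ : GL (Fin 2) L) : Matrix (Fin 2) (Fin 2) L) = !![2⁻¹, 2⁻¹; 1, -1])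
    (g : adelicUnitaryGroup L (Matrix.of fun i j : Fin 2 => if i.val + j.val + 1 = 2 then (1 : L) else 0)) :
    IsSiegelDelta L (Equiv.prodUnique (Fin 1) (Fin 1)) (fun _ => (1 : L)) (fun _ => map_one _) (fun _ => (1 : L)) (fun _ => map_one _)
        (adelicUnitaryGroupCongr L S _ _ (bridge_congr L S hS) g) ↔
      ((g : GL (Fin 2) (AdeleRing (𝓞 L) L)) : Matrix (Fin 2) (Fin 2) (AdeleRing (𝓞 L) L)) 1 0 = 0 := by
  have ht : algebraMap L (AdeleRing (𝓞 L) L) 2⁻¹ + algebraMap L (AdeleRing (𝓞 L) L) 2⁻¹ = 1 := by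
    rw [← map_add, show (2⁻¹ : L) + 2⁻¹ = 1 by norm_num, map_one]
  obtain ⟨h1, h2⟩ := bridge_rowsum L S hS hS' g
  rw [isSiegelDelta_one_iff]
  change ((toAdeleGL L S * (g : GL (Fin 2) (AdeleRing (𝓞 L) L)) * (toAdeleGL L S)⁻¹ : GL (Fin 2) (AdeleRing (𝓞 L) L)) :
        Matrix (Fin 2) (Fin 2) (AdeleRing (𝓞 L) L)) 0 0 +
      ((toAdeleGL L S * (g : GL (Fin 2) (AdeleRing (𝓞 L) L)) * (toAdeleGL L S)⁻¹ : GL (Fin 2) (AdeleRing (𝓞 L) L)) :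
        Matrix (Fin 2) (Fin 2) (AdeleRing (𝓞 L) L)) 0 1 =
      ((toAdeleGL L S * (g : GL (Fin 2) (AdeleRing (𝓞 L) L)) * (toAdeleGL L S)⁻¹ : GL (Fin 2) (AdeleRing (𝓞 L) L)) :
        Matrix (Fin 2) (Fin 2) (AdeleRing (𝓞 L) L)) 1 0 +
      ((toAdeleGL L S * (g : GL (Fin 2) (AdeleRing (𝓞 L) L)) * (toAdeleGL L S)⁻¹ : GL (Fin 2) (AdeleRing (𝓞 L) L)) :
        Matrix (Fin 2) (Fin 2) (AdeleRing (𝓞 L) L)) 1 1 ↔ _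
  rw [h1, h2]
  constructor
  · intro h
    have h3 : (algebraMap L (AdeleRing (𝓞 L) L) 2⁻¹ + algebraMap L (AdeleRing (𝓞 L) L) 2⁻¹) *
        ((g : GL (Fin 2) (AdeleRing (𝓞 L) L)) : Matrix (Fin 2) (Fin 2) (AdeleRing (𝓞 L) L)) 1 0 = 0 := by
      linear_combination h
    rwa [ht, one_mul] at h3
  · intro h
    rw [h, mul_zero, add_zero, sub_zero]

/-- **`det_Δ(Ψ_S b) = b₀₀` ON THE BOREL**: for `b₁₀ = 0` the action of `Ψ_S b` on `Δ ≅ 𝔸_L` is multiplication by `b₀₀` — so K2Liu's inducing character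
`χ(det_Δ p)|det_Δ p|^{s + n/2}` (`n = 1`) pulls back to `χ(b₀₀)‖b₀₀‖_{𝔸_L}^{s + 1/2}`, the NORMALISED rank-one induction of `U(1,1)`. [cite: Tan1999, §1]
[cite: MoeglinWaldspurger1995, I.1.4] -/
theorem detDelta_bridge (S : GL (Fin 2) L) (hS : (S : Matrix (Fin 2) (Fin 2) L) = !![1, 2⁻¹; 1, -2⁻¹])
    (hS' : ((S⁻¹ : GL (Fin 2) L) : Matrix (Fin 2) (Fin 2) L) = !![2⁻¹, 2⁻¹; 1, -1])
    (g : adelicUnitaryGroup L (Matrix.of fun i j : Fin 2 => if i.val + j.val + 1 = 2 then (1 : L) else 0))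
    (hg : ((g : GL (Fin 2) (AdeleRing (𝓞 L) L)) : Matrix (Fin 2) (Fin 2) (AdeleRing (𝓞 L) L)) 1 0 = 0) :
    detDelta L (Equiv.prodUnique (Fin 1) (Fin 1)) (fun _ => (1 : L)) (fun _ => map_one _) (fun _ => (1 : L)) (fun _ => map_one _)
        (adelicUnitaryGroupCongr L S _ _ (bridge_congr L S hS) g) =
      ((g : GL (Fin 2) (AdeleRing (𝓞 L) L)) : Matrix (Fin 2) (Fin 2) (AdeleRing (𝓞 L) L)) 0 0 := by
  obtain ⟨h1, -⟩ := bridge_rowsum L S hS hS' g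
  rw [detDelta_one_eq]
  change ((toAdeleGL L S * (g : GL (Fin 2) (AdeleRing (𝓞 L) L)) * (toAdeleGL L S)⁻¹ : GL (Fin 2) (AdeleRing (𝓞 L) L)) :
        Matrix (Fin 2) (Fin 2) (AdeleRing (𝓞 L) L)) 0 0 +
      ((toAdeleGL L S * (g : GL (Fin 2) (AdeleRing (𝓞 L) L)) * (toAdeleGL L S)⁻¹ : GL (Fin 2) (AdeleRing (𝓞 L) L)) :
        Matrix (Fin 2) (Fin 2) (AdeleRing (𝓞 L) L)) 0 1 = _
  rw [h1, hg, mul_zero, add_zero]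

/-- **The Borel is mapped onto itself by inversion inside `P_Δ`**: if `(Ψ_S b) ∈ P_Δ(𝔸)` then also `b⁻¹` has corner `0` (★ `isSiegelDelta_inv`). [folklore] -/
theorem inv_apply_one_zero_eq_zero (S : GL (Fin 2) L) (hS : (S : Matrix (Fin 2) (Fin 2) L) = !![1, 2⁻¹; 1, -2⁻¹])
    (hS' : ((S⁻¹ : GL (Fin 2) L) : Matrix (Fin 2) (Fin 2) L) = !![2⁻¹, 2⁻¹; 1, -1])
    (b : adelicUnitaryGroup L (Matrix.of fun i j : Fin 2 => if i.val + j.val + 1 = 2 then (1 : L) else 0))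
    (hb : ((b : GL (Fin 2) (AdeleRing (𝓞 L) L)) : Matrix (Fin 2) (Fin 2) (AdeleRing (𝓞 L) L)) 1 0 = 0) :
    (((b⁻¹ : adelicUnitaryGroup L (Matrix.of fun i j : Fin 2 => if i.val + j.val + 1 = 2 then (1 : L) else 0)) : GL (Fin 2) (AdeleRing (𝓞 L) L)) :
        Matrix (Fin 2) (Fin 2) (AdeleRing (𝓞 L) L)) 1 0 = 0 := by
  have h := (isSiegelDelta_bridge_iff L S hS hS' b).2 hb
  have h' := isSiegelDelta_inv L (Equiv.prodUnique (Fin 1) (Fin 1)) (fun _ => (1 : L)) (fun _ => map_one _) (fun _ => (1 : L)) (fun _ => map_one _) h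
  refine (isSiegelDelta_bridge_iff L S hS hS' b⁻¹).1 ?_
  rw [map_inv]
  exact h'

/-- **The corner entry `b₀₀` of a Borel element is a unit** (`b₀₀ · (b⁻¹)₀₀ = 1`, both corners `b₁₀`, `(b⁻¹)₁₀` being `0`). [folklore] -/
theorem isUnit_apply_zero_zero (S : GL (Fin 2) L) (hS : (S : Matrix (Fin 2) (Fin 2) L) = !![1, 2⁻¹; 1, -2⁻¹])
    (hS' : ((S⁻¹ : GL (Fin 2) L) : Matrix (Fin 2) (Fin 2) L) = !![2⁻¹, 2⁻¹; 1, -1])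
    (b : adelicUnitaryGroup L (Matrix.of fun i j : Fin 2 => if i.val + j.val + 1 = 2 then (1 : L) else 0))
    (hb : ((b : GL (Fin 2) (AdeleRing (𝓞 L) L)) : Matrix (Fin 2) (Fin 2) (AdeleRing (𝓞 L) L)) 1 0 = 0) :
    IsUnit (((b : GL (Fin 2) (AdeleRing (𝓞 L) L)) : Matrix (Fin 2) (Fin 2) (AdeleRing (𝓞 L) L)) 0 0) := by
  have hb' := inv_apply_one_zero_eq_zero L S hS hS' b hb
  have h1 : ((b : GL (Fin 2) (AdeleRing (𝓞 L) L)) : Matrix (Fin 2) (Fin 2) (AdeleRing (𝓞 L) L)) 0 0 *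
      (((b⁻¹ : adelicUnitaryGroup L _) : GL (Fin 2) (AdeleRing (𝓞 L) L)) : Matrix (Fin 2) (Fin 2) (AdeleRing (𝓞 L) L)) 0 0 = 1 := by
    have hmul : (((b * b⁻¹ : adelicUnitaryGroup L _) : GL (Fin 2) (AdeleRing (𝓞 L) L)) : Matrix (Fin 2) (Fin 2) (AdeleRing (𝓞 L) L)) 0 0 = 1 := by
      rw [mul_inv_cancel, OneMemClass.coe_one, Units.val_one, Matrix.one_apply_eq]
    rw [Subgroup.coe_mul, Units.val_mul, Matrix.mul_apply, Fin.sum_univ_two, hb', mul_zero, add_zero] at hmul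
    exact hmul
  have h2 : (((b⁻¹ : adelicUnitaryGroup L _) : GL (Fin 2) (AdeleRing (𝓞 L) L)) : Matrix (Fin 2) (Fin 2) (AdeleRing (𝓞 L) L)) 0 0 *
      ((b : GL (Fin 2) (AdeleRing (𝓞 L) L)) : Matrix (Fin 2) (Fin 2) (AdeleRing (𝓞 L) L)) 0 0 = 1 := by
    rw [mul_comm]; exact h1
  exact isUnit_iff_exists.2 ⟨_, h1, h2⟩

/-- **BOREL SECTIONS OF `U(Φ₂)` ARE SIEGEL SECTIONS OF `U(𝕍 ⊕ −𝕍)` AT `n = 1`.**  If `F : U(Φ₂)(𝔸) → ℂ` transforms under the Borel by the NORMALISED rank-one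
character, `F(b g) = χ(b₀₀) · ‖b₀₀‖_{𝔸_L}^{s + 1/2} · F(g)` for `b₁₀ = 0` (written, as in ★ `siegelDeltaCharacter`, `χ(u)·(√‖u‖)^{2s+1}` for the idele `u = b₀₀`),
then `F ∘ Ψ_S⁻¹` is a Siegel section of `I_Δ(s, χ)` (★ `IsSiegelDeltaSection`), to which every ★ K2Liu theorem applies. [cite: Tan1999, §1]
[cite: MoeglinWaldspurger1995, I.1.4, II.1.5] -/
theorem isSiegelDeltaSection_comp_bridge_symm (S : GL (Fin 2) L) (hS : (S : Matrix (Fin 2) (Fin 2) L) = !![1, 2⁻¹; 1, -2⁻¹])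
    (hS' : ((S⁻¹ : GL (Fin 2) L) : Matrix (Fin 2) (Fin 2) L) = !![2⁻¹, 2⁻¹; 1, -1]) (χ : HeckeCharacter L) (s : ℂ)
    {F : adelicUnitaryGroup L (Matrix.of fun i j : Fin 2 => if i.val + j.val + 1 = 2 then (1 : L) else 0) → ℂ}
    (hF : ∀ (b g : adelicUnitaryGroup L (Matrix.of fun i j : Fin 2 => if i.val + j.val + 1 = 2 then (1 : L) else 0)) (u : (AdeleRing (𝓞 L) L)ˣ),
      ((b : GL (Fin 2) (AdeleRing (𝓞 L) L)) : Matrix (Fin 2) (Fin 2) (AdeleRing (𝓞 L) L)) 1 0 = 0 →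
      (u : AdeleRing (𝓞 L) L) = ((b : GL (Fin 2) (AdeleRing (𝓞 L) L)) : Matrix (Fin 2) (Fin 2) (AdeleRing (𝓞 L) L)) 0 0 →
        F (b * g) = ((χ u : ℂˣ) : ℂ) * ((Real.sqrt (ideleNorm u) : ℝ) : ℂ) ^ (2 * s + 1) * F g) :
    IsSiegelDeltaSection L (Equiv.prodUnique (Fin 1) (Fin 1)) (fun _ => (1 : L)) (fun _ => map_one _) (fun _ => (1 : L)) (fun _ => map_one _) χ s
      (fun h => F ((adelicUnitaryGroupCongr L S _ _ (bridge_congr L S hS)).symm h)) := by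
  intro p hp h
  set b := (adelicUnitaryGroupCongr L S _ _ (bridge_congr L S hS)).symm p with hbdef
  have hbp : adelicUnitaryGroupCongr L S _ _ (bridge_congr L S hS) b = p := ContinuousMulEquiv.apply_symm_apply _ p
  have hp' : IsSiegelDelta L (Equiv.prodUnique (Fin 1) (Fin 1)) (fun _ => (1 : L)) (fun _ => map_one _) (fun _ => (1 : L)) (fun _ => map_one _)
      (adelicUnitaryGroupCongr L S _ _ (bridge_congr L S hS) b) := by rw [hbp]; exact hp
  have hb10 := (isSiegelDelta_bridge_iff L S hS hS' b).1 hp'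
  obtain ⟨u, hu⟩ := isUnit_apply_zero_zero L S hS hS' b hb10
  -- `det_Δ p = b₀₀ = u`
  have hdet : detDelta L (Equiv.prodUnique (Fin 1) (Fin 1)) (fun _ => (1 : L)) (fun _ => map_one _) (fun _ => (1 : L)) (fun _ => map_one _) p =
      (u : AdeleRing (𝓞 L) L) := by
    rw [← hbp, detDelta_bridge L S hS hS' b hb10, hu]
  have hdu : IsUnit (detDelta L (Equiv.prodUnique (Fin 1) (Fin 1)) (fun _ => (1 : L)) (fun _ => map_one _) (fun _ => (1 : L)) (fun _ => map_one _) p) :=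
    hdet ▸ Units.isUnit u
  have hunit : hdu.unit = u := Units.ext (by rw [IsUnit.unit_spec, hdet])
  -- the section law
  have hmul : (adelicUnitaryGroupCongr L S _ _ (bridge_congr L S hS)).symm (p * h) =
      b * (adelicUnitaryGroupCongr L S _ _ (bridge_congr L S hS)).symm h :=
    map_mul (adelicUnitaryGroupCongr L S _ _ (bridge_congr L S hS)).symm p h
  simp only []
  rw [hmul, hF b _ u hb10 hu]
  simp only [siegelDeltaCharacter, chiDet, modDelta, dif_pos hdu]
  rw [hunit, Nat.cast_one]

/-! ## §3 Rational points: `B(L⁺) ↦ P_Δ(L⁺)` -/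

/-- The route's arithmetic subgroup of `(cmDatum L 2 Φ₂)` is the rational subgroup `U(Φ₂)(L⁺)` of ★ `AdelicUnitaryGroup` (same diagonal embedding `toAdeleGL`).
[folklore] -/
theorem mem_adelicUnitaryRat_of_mem_arithmeticSubgroup
    {γ : adelicUnitaryGroup L (Matrix.of fun i j : Fin 2 => if i.val + j.val + 1 = 2 then (1 : L) else 0)}
    (hγ : γ ∈ (cmDatum L 2 (Matrix.of fun i j : Fin 2 => if i.val + j.val + 1 = 2 then (1 : L) else 0)).arithmeticSubgroup) :
    γ ∈ adelicUnitaryRat L (Matrix.of fun i j : Fin 2 => if i.val + j.val + 1 = 2 then (1 : L) else 0) := by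
  obtain ⟨x, hx⟩ := hγ
  rw [mem_adelicUnitaryRat_iff]
  refine ⟨x.1, x.2, ?_⟩
  rw [← hx]
  rfl

/-- Conversely every rational point of ★ `AdelicUnitaryGroup` lies in the route's arithmetic subgroup. [folklore] -/
theorem mem_arithmeticSubgroup_of_mem_adelicUnitaryRat
    {γ : adelicUnitaryGroup L (Matrix.of fun i j : Fin 2 => if i.val + j.val + 1 = 2 then (1 : L) else 0)}
    (hγ : γ ∈ adelicUnitaryRat L (Matrix.of fun i j : Fin 2 => if i.val + j.val + 1 = 2 then (1 : L) else 0)) :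
    γ ∈ (cmDatum L 2 (Matrix.of fun i j : Fin 2 => if i.val + j.val + 1 = 2 then (1 : L) else 0)).arithmeticSubgroup := by
  rw [mem_adelicUnitaryRat_iff] at hγ
  obtain ⟨x, hx, hxγ⟩ := hγ
  refine ⟨⟨x, hx⟩, Subtype.ext ?_⟩
  rw [← hxγ]
  rfl

/-- **`Ψ_S` MAPS `U(Φ₂)(L⁺)` INTO `H(L⁺)`** (★ `adelicUnitaryGroupCongr_mem_rat`; `S` is rational): the image of a rational point lies in ★ `ratH`. [folklore] -/
theorem bridge_mem_ratH (S : GL (Fin 2) L) (hS : (S : Matrix (Fin 2) (Fin 2) L) = !![1, 2⁻¹; 1, -2⁻¹])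
    {γ : adelicUnitaryGroup L (Matrix.of fun i j : Fin 2 => if i.val + j.val + 1 = 2 then (1 : L) else 0)}
    (hγ : γ ∈ (cmDatum L 2 (Matrix.of fun i j : Fin 2 => if i.val + j.val + 1 = 2 then (1 : L) else 0)).arithmeticSubgroup) :
    (adelicUnitaryGroupCongr L S _ _ (bridge_congr L S hS) γ :
        HA L (Equiv.prodUnique (Fin 1) (Fin 1)) (fun _ => (1 : L)) (fun _ => map_one _) (fun _ => (1 : L)) (fun _ => map_one _)) ∈
      ratH L (Equiv.prodUnique (Fin 1) (Fin 1)) (fun _ => (1 : L)) (fun _ => map_one _) (fun _ => (1 : L)) (fun _ => map_one _) := by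
  have h := adelicUnitaryGroupCongr_mem_rat L S _ _ (bridge_congr L S hS) (mem_adelicUnitaryRat_of_mem_arithmeticSubgroup L hγ)
  rw [mem_adelicUnitaryRat_iff] at h
  obtain ⟨x, hx, hxe⟩ := h
  refine ⟨⟨x, (rational_complexConj L (1 + 1) _).symm ▸ hx⟩, Subtype.ext ?_⟩
  rw [← hxe]
  rfl

/-- **… AND `Ψ_S⁻¹` MAPS `H(L⁺)` INTO `U(Φ₂)(L⁺)`** (the inverse congruence `S⁻¹` is rational too). [folklore] -/
theorem bridge_symm_mem_arithmeticSubgroup (S : GL (Fin 2) L) (hS : (S : Matrix (Fin 2) (Fin 2) L) = !![1, 2⁻¹; 1, -2⁻¹])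
    {δ : HA L (Equiv.prodUnique (Fin 1) (Fin 1)) (fun _ => (1 : L)) (fun _ => map_one _) (fun _ => (1 : L)) (fun _ => map_one _)}
    (hδ : δ ∈ ratH L (Equiv.prodUnique (Fin 1) (Fin 1)) (fun _ => (1 : L)) (fun _ => map_one _) (fun _ => (1 : L)) (fun _ => map_one _)) :
    (adelicUnitaryGroupCongr L S _ _ (bridge_congr L S hS)).symm δ ∈
      (cmDatum L 2 (Matrix.of fun i j : Fin 2 => if i.val + j.val + 1 = 2 then (1 : L) else 0)).arithmeticSubgroup := by
  obtain ⟨x, hxδ⟩ := hδ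
  refine mem_arithmeticSubgroup_of_mem_adelicUnitaryRat L ?_
  rw [mem_adelicUnitaryRat_iff]
  refine ⟨S⁻¹ * (x.1 : GL (Fin 2) L) * S, ?_, ?_⟩
  · -- `S⁻¹ x S ∈ U(Φ₂)(L)`: conjugation by the inverse congruence
    have hx : (x.1 : GL (Fin 2) L) ∈ Literature.AlgebraicGeometry.ShimuraVarieties.unitaryGroup (cmConjRingHom L)
        (hermD L (Equiv.prodUnique (Fin 1) (Fin 1)) (fun _ => (1 : L)) (fun _ => map_one _) (fun _ => (1 : L)) (fun _ => map_one _)) := by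
      rw [← rational_complexConj L (1 + 1)]; exact x.2
    have h := conj_mem_unitaryGroup_of_congr (cmConjRingHom L) S⁻¹ _ _ (matrix_congr_inv (cmConjRingHom L) S _ _ (bridge_congr L S hS)) hx
    simpa only [inv_inv] using h
  · rw [← hxδ, map_mul, map_mul, map_inv]
    rfl

end Summit.HodgeConjecture.HodgeConjecture.Cruxes.H413.K2E1BorelEisensteinU2FromK2Liu

end
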